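import Summits.FinalStateConjecture.FinalStateConjecture.Theses.PhotonSphereChannels
import Summits.FinalStateConjecture.FinalStateConjecture.Theorems.PhotonSphereChannelsExteriorEnergyRW
import Literature.Analysis.PDE.Wave1DChannelScaling

/-!
# Crux `WindowedShellChannels` (stmt-FinalStateConjecture-14085), line `SketchIdeator3` — stub `stub_unitMass`

Reduction to unit mass by the scaling `(t, x) ↦ (Mt, Mx)` of the Regge–Wheeler equation on the centred tortoise line.

The mass is a pure scale: `y ↦ M⁻¹ · tortoiseRadius hM 0 (M y)` is a unit-mass tortoise radius
function centred at `0`, hence equals `tortoiseRadius one_pos 0` (`IsTortoiseRadius.unique`), and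
`rwPotential 1 s ℓ ρ₁ = M² · rwPotential M s ℓ (M ρ₁)`, so the unit-mass line potential is
`V₁(y) = M² V(M y)`, `V` the mass-`M` one.  For a general potential `V` and scale `M > 0`
(sub-namespace `UnitMass`): `ψ₁(τ, y) := ψ(Mτ, My)` solves the `V₁`-equation when `ψ` solves the
`V`-equation (`iteratedDeriv_two_comp_affine`), `e₁(τ, y) = M² e(Mτ, My)` (`deriv_comp_mul_left`),
so — Lebesgue measure scaling by `M⁻¹` under `y ↦ My` — `E(ψ₁)(τ) = M · E(ψ)(Mτ)`,
`E_ext^{0,a}(ψ₁)(τ) = M · E_ext^{0,Ma}(ψ)(Mτ)` and `ch⁺_{0,a}(ψ₁) = M · ch⁺_{0,Ma}(ψ)`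
(`liminf` commutes with `τ ↦ Mτ` and with the finite constant `M`); Cauchy data supported off
`{|x| ≤ ρ}` become data supported off `{|y| ≤ ρ/M}`.  The unit-mass statement at `ρ/M` with
constants `(h, c)` gives the mass-`M` statement at `ρ` with `(M h, c)` after cancelling the common
factor `ofReal M`.  No definitions: the rescaled solution is the literal lambda
`fun t y => ψ (M * t) (M * y)`.
-/

noncomputable section

set_option linter.dupNamespace false

namespace Summit.FinalStateConjecture.FinalStateConjecture.Theorems.WindowedShellChannelsStubs

open Literature.Geometry.Lorentzian Literature.Geometry.Lorentzian.ReggeWheeler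
open Summit.FinalStateConjecture.FinalStateConjecture.Theses.PhotonSphereChannels
open Filter Set MeasureTheory
open scoped ENNReal Topology

namespace UnitMass

section General

variable {V : ℝ → ℝ} {ψ : ℝ → ℝ → ℝ}

/-- The rescaling `ψ(M·, M·)` of a global `C²` solution for the potential `V` is a global `C²`
solution for the rescaled potential `M² V(M·)`. -/
theorem isSolution_scale (hψ : IsSolution V ψ) (M : ℝ) :
    IsSolution (fun y => M ^ 2 * V (M * y)) (fun t y => ψ (M * t) (M * y)) := by
  refine ⟨hψ.1.comp ((contDiff_const.mul contDiff_fst).prodMk (contDiff_const.mul contDiff_snd)),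
    fun z => ?_⟩
  have h := hψ.2 (M * z.1, M * z.2)
  have h1 : iteratedDeriv 2 (fun τ => ψ (M * τ) (M * z.2)) z.1
      = M ^ 2 * iteratedDeriv 2 (fun τ => ψ τ (M * z.2)) (M * z.1) := by
    have e := Literature.Analysis.PDE.iteratedDeriv_two_comp_affine (fun τ => ψ τ (M * z.2)) M 0 z.1
    simpa only [add_zero] using e
  have h2 : iteratedDeriv 2 (fun y => ψ (M * z.1) (M * y)) z.2
      = M ^ 2 * iteratedDeriv 2 (ψ (M * z.1)) (M * z.2) := by
    have e := Literature.Analysis.PDE.iteratedDeriv_two_comp_affine (ψ (M * z.1)) M 0 z.2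
    simpa only [add_zero] using e
  unfold IsSolutionAt at h ⊢
  simp only at h ⊢
  rw [h1, h2]
  linear_combination M ^ 2 * h

/-- The energy density of the rescaled function: `e₁(t, y) = M² e(Mt, My)`. -/
theorem energyDensity_scale (V : ℝ → ℝ) (ψ : ℝ → ℝ → ℝ) (M t y : ℝ) :
    energyDensity (fun y => M ^ 2 * V (M * y)) (fun t y => ψ (M * t) (M * y)) t y
      = M ^ 2 * energyDensity V ψ (M * t) (M * y) := by
  unfold energyDensity
  have h1 : deriv (fun τ => ψ (M * τ) (M * y)) t = M * deriv (fun τ => ψ τ (M * y)) (M * t) :=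
    deriv_comp_mul_left M (fun τ => ψ τ (M * y)) t
  have h2 : deriv (fun x => ψ (M * t) (M * x)) y = M * deriv (ψ (M * t)) (M * y) :=
    deriv_comp_mul_left M (ψ (M * t)) y
  rw [h1, h2]
  ring

/-- Cauchy data supported off `{|x| ≤ ρ}` rescale to Cauchy data supported off `{|y| ≤ ρ/M}`. -/
theorem supported_scale {M ρ : ℝ} (hM : 0 < M)
    (hsupp : CauchyDataSupportedOn ψ {x : ℝ | ρ < |x|}) :
    CauchyDataSupportedOn (fun t y => ψ (M * t) (M * y)) {y : ℝ | ρ / M < |y|} := by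
  intro y hy
  have hx : M * y ∉ {x : ℝ | ρ < |x|} := by
    simp only [mem_setOf_eq, not_lt, abs_mul, abs_of_pos hM] at hy ⊢
    exact (le_div_iff₀' hM).1 hy
  obtain ⟨h0, h1⟩ := hsupp (M * y) hx
  refine ⟨?_, ?_⟩
  · show ψ (M * 0) (M * y) = 0
    rw [mul_zero]
    exact h0
  · show deriv (fun τ => ψ (M * τ) (M * y)) 0 = 0
    have hd : deriv (fun τ => ψ (M * τ) (M * y)) 0 = M * deriv (fun τ => ψ τ (M * y)) (M * 0) :=
      deriv_comp_mul_left M (fun τ => ψ τ (M * y)) 0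
    rw [hd, mul_zero, h1, mul_zero]

/-- Linear change of variables `x = My` (`M > 0`) in the lower Lebesgue integral on the line:
`∫ f(My) dy = M⁻¹ ∫ f(x) dx`. -/
theorem lintegral_comp_scale {M : ℝ} (hM : 0 < M) (f : ℝ → ℝ≥0∞) :
    ∫⁻ y, f (M * y) = ENNReal.ofReal M⁻¹ * ∫⁻ x, f x := by
  have h1 : ∫⁻ y, f (M * y) = ∫⁻ x, f x ∂(Measure.map (fun y => M * y) volume) := by
    rw [show (fun y => M * y) = ⇑(Homeomorph.mulLeft₀ M hM.ne').toMeasurableEquiv from rfl,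
      lintegral_map_equiv]
    rfl
  rw [h1, Real.map_volume_mul_left hM.ne', lintegral_smul_measure, smul_eq_mul,
    abs_of_pos (inv_pos.2 hM)]

/-- The same change of variables over a measurable set `S` and its preimage under `y ↦ My`. -/
theorem setLIntegral_comp_scale {M : ℝ} (hM : 0 < M) (f : ℝ → ℝ≥0∞) {S : Set ℝ}
    (hS : MeasurableSet S) :
    ∫⁻ y in (fun y => M * y) ⁻¹' S, f (M * y) = ENNReal.ofReal M⁻¹ * ∫⁻ x in S, f x := by
  rw [← lintegral_indicator hS, ← lintegral_indicator (measurable_const_mul M hS)]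
  have h : (fun y => ((fun y => M * y) ⁻¹' S).indicator (fun y => f (M * y)) y)
      = fun y => S.indicator f (M * y) :=
    funext fun y => Set.indicator_comp_right (fun y => M * y)
  rw [h]
  exact lintegral_comp_scale hM (S.indicator f)

/-- Total energies of the rescaled function: `E(ψ₁)(t) = M · E(ψ)(Mt)`. -/
theorem totalEnergy_scale {M : ℝ} (hM : 0 < M) (V : ℝ → ℝ) (ψ : ℝ → ℝ → ℝ) (t : ℝ) :
    totalEnergy (fun y => M ^ 2 * V (M * y)) (fun t y => ψ (M * t) (M * y)) t
      = ENNReal.ofReal M * totalEnergy V ψ (M * t) := by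
  unfold totalEnergy
  have hfun : (fun y => ENNReal.ofReal
      (energyDensity (fun y => M ^ 2 * V (M * y)) (fun t y => ψ (M * t) (M * y)) t y))
      = fun y => ENNReal.ofReal (M ^ 2)
          * (fun x => ENNReal.ofReal (energyDensity V ψ (M * t) x)) (M * y) := by
    funext y
    rw [energyDensity_scale, ENNReal.ofReal_mul (by positivity)]
  rw [hfun, lintegral_const_mul' _ _ ENNReal.ofReal_ne_top,
    lintegral_comp_scale hM (fun x => ENNReal.ofReal (energyDensity V ψ (M * t) x)),
    ← mul_assoc, ← ENNReal.ofReal_mul (by positivity)]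
  congr 2
  rw [sq, mul_assoc, mul_inv_cancel₀ hM.ne', mul_one]

/-- Exterior energies of the rescaled function about the centre `0`:
`E_ext^{0,a}(ψ₁)(t) = M · E_ext^{0,Ma}(ψ)(Mt)`. -/
theorem exteriorEnergy_scale {M : ℝ} (hM : 0 < M) (V : ℝ → ℝ) (ψ : ℝ → ℝ → ℝ) (a t : ℝ) :
    exteriorEnergy (fun y => M ^ 2 * V (M * y)) 0 a (fun t y => ψ (M * t) (M * y)) t
      = ENNReal.ofReal M * exteriorEnergy V 0 (M * a) ψ (M * t) := by
  unfold exteriorEnergy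
  have hfun : (fun y => ENNReal.ofReal
      (energyDensity (fun y => M ^ 2 * V (M * y)) (fun t y => ψ (M * t) (M * y)) t y))
      = fun y => ENNReal.ofReal (M ^ 2)
          * (fun x => ENNReal.ofReal (energyDensity V ψ (M * t) x)) (M * y) := by
    funext y
    rw [energyDensity_scale, ENNReal.ofReal_mul (by positivity)]
  have hset : {y : ℝ | a + |t| < |y - 0|}
      = (fun y => M * y) ⁻¹' {x : ℝ | M * a + |M * t| < |x - 0|} := by
    ext y
    simp only [mem_setOf_eq, mem_preimage, sub_zero, abs_mul, abs_of_pos hM, ← mul_add]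
    exact (mul_lt_mul_iff_right₀ hM).symm
  have hS : MeasurableSet {x : ℝ | M * a + |M * t| < |x - 0|} :=
    (isOpen_lt continuous_const (by fun_prop)).measurableSet
  rw [hfun, hset, lintegral_const_mul' _ _ ENNReal.ofReal_ne_top,
    setLIntegral_comp_scale hM (fun x => ENNReal.ofReal (energyDensity V ψ (M * t) x)) hS,
    ← mul_assoc, ← ENNReal.ofReal_mul (by positivity)]
  congr 2
  rw [sq, mul_assoc, mul_inv_cancel₀ hM.ne', mul_one]

/-- Forward channel energies of the rescaled function about the centre `0`:
`ch⁺_{0,a}(ψ₁) = M · ch⁺_{0,Ma}(ψ)` (`liminf` commutes with `τ ↦ Mτ` and with the constant `M`). -/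
theorem channelEnergy_scale {M : ℝ} (hM : 0 < M) (V : ℝ → ℝ) (ψ : ℝ → ℝ → ℝ) (a : ℝ) :
    channelEnergy (fun y => M ^ 2 * V (M * y)) 0 a (fun t y => ψ (M * t) (M * y)) atTop
      = ENNReal.ofReal M * channelEnergy V 0 (M * a) ψ atTop := by
  unfold channelEnergy
  have hfun : exteriorEnergy (fun y => M ^ 2 * V (M * y)) 0 a (fun t y => ψ (M * t) (M * y))
      = fun t => ENNReal.ofReal M * exteriorEnergy V 0 (M * a) ψ (M⁻¹⁻¹ * t) :=
    funext fun t => by rw [exteriorEnergy_scale hM, inv_inv]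
  rw [hfun, Literature.Analysis.PDE.liminf_const_mul_ennreal ENNReal.ofReal_ne_top,
    (Literature.Analysis.PDE.liminf_comp_inv_mul (inv_pos.2 hM) _).1]

end General

/-! ### The mass as a scale of the centred tortoise line -/

/-- Mass scaling of the centred tortoise radius function:
`tortoiseRadius hM 0 (M y) = M · tortoiseRadius one_pos 0 y` (uniqueness of tortoise radius
functions: `y ↦ M⁻¹ tortoiseRadius hM 0 (M y)` is a unit-mass one centred at `0`). -/
theorem tortoiseRadius_mul {M : ℝ} (hM : 0 < M) (y : ℝ) :
    tortoiseRadius hM 0 (M * y) = M * tortoiseRadius one_pos 0 y := by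
  have hr := isTortoiseRadius_tortoiseRadius hM 0
  have key : tortoiseRadius one_pos 0 = fun y => M⁻¹ * tortoiseRadius hM 0 (M * y) := by
    refine (isTortoiseRadius_tortoiseRadius one_pos 0).unique ⟨fun y => ?_, fun y => ?_, ?_⟩
    · rw [lt_inv_mul_iff₀ hM]
      have := hr.two_mul_lt (M * y)
      linarith
    · have h1 := ((hr.hasDerivAt (M * y)).comp y ((hasDerivAt_id' y).const_mul M)).const_mul M⁻¹
      refine h1.congr_deriv ?_
      have hpos : 0 < tortoiseRadius hM 0 (M * y) := hr.pos (M * y)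
      field_simp
    · show M⁻¹ * tortoiseRadius hM 0 (M * 0) = 3 * 1
      rw [mul_zero, hr.center]
      field_simp
  rw [key]
  simp only
  rw [mul_inv_cancel_left₀ hM.ne']

/-- The unit-mass line potential is the rescaled mass-`M` one:
`V_{s,ℓ}^{M=1}(y) = M² · V_{s,ℓ}^{M}(M y)` along the centred tortoise lines. -/
theorem linePotential_one_eq {M : ℝ} (hM : 0 < M) (s ℓ : ℕ) :
    linePotential 1 s ℓ (tortoiseRadius one_pos 0)
      = fun y => M ^ 2 * linePotential M s ℓ (tortoiseRadius hM 0) (M * y) := by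
  funext y
  simp only [linePotential_apply, tortoiseRadius_mul hM y]
  have hr : 0 < tortoiseRadius one_pos 0 y := (isTortoiseRadius_tortoiseRadius one_pos 0).pos y
  unfold rwPotential
  field_simp

end UnitMass

/-- REDUCTION (mass scaling): `ψ₁(τ, y) := ψ(Mτ, My)` is a unit-mass solution along
`tortoiseRadius one_pos 0 = M⁻¹ • tortoiseRadius hM 0 (M • ·)` (uniqueness of tortoise radius functions), with
`e₁(τ, y) = M² e(Mτ, My)`, energies `× M`, apertures `× M⁻¹`; the unit-mass statement at `ρ/M` gives mass `M` at `ρ`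
with `h ↦ M h`, same `c`. -/
theorem stub_unitMass (σ : ℝ)
    (H : ∀ ρ : ℝ, 0 < ρ → ∃ h : ℝ, 0 ≤ h ∧ ∃ c : ℝ, 0 < c ∧
        ∀ (s ℓ : ℕ), s ≤ 2 → s ≤ ℓ → ∀ ψ : ℝ → ℝ → ℝ,
          IsRWSolution 1 s ℓ (tortoiseRadius one_pos 0) ψ → (∀ t x, ψ (-t) x = σ * ψ t x) →
          CauchyDataSupportedOn ψ {x : ℝ | ρ < |x|} →
          totalEnergy (linePotential 1 s ℓ (tortoiseRadius one_pos 0)) ψ 0 ≠ ⊤ →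
            ENNReal.ofReal c * totalEnergy (linePotential 1 s ℓ (tortoiseRadius one_pos 0)) ψ 0 ≤
              channelEnergy (linePotential 1 s ℓ (tortoiseRadius one_pos 0)) 0 (ρ - h) ψ atTop) :
    ∀ (M : ℝ) (hM : 0 < M), ∀ ρ : ℝ, 0 < ρ → ∃ h : ℝ, 0 ≤ h ∧ ∃ c : ℝ, 0 < c ∧
      ∀ (s ℓ : ℕ), s ≤ 2 → s ≤ ℓ → ∀ ψ : ℝ → ℝ → ℝ,
        IsRWSolution M s ℓ (tortoiseRadius hM 0) ψ → (∀ t x, ψ (-t) x = σ * ψ t x) →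
        CauchyDataSupportedOn ψ {x : ℝ | ρ < |x|} →
        totalEnergy (linePotential M s ℓ (tortoiseRadius hM 0)) ψ 0 ≠ ⊤ →
          ENNReal.ofReal c * totalEnergy (linePotential M s ℓ (tortoiseRadius hM 0)) ψ 0 ≤
            channelEnergy (linePotential M s ℓ (tortoiseRadius hM 0)) 0 (ρ - h) ψ atTop := by
  intro M hM ρ hρ
  obtain ⟨h₁, hh₁, c, hc, H'⟩ := H (ρ / M) (div_pos hρ hM)
  refine ⟨M * h₁, mul_nonneg hM.le hh₁, c, hc, fun s ℓ hs hsℓ ψ hψ hpar hsupp hE => ?_⟩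
  have hV := UnitMass.linePotential_one_eq hM s ℓ
  have hsol : IsRWSolution 1 s ℓ (tortoiseRadius one_pos 0) (fun t y => ψ (M * t) (M * y)) := by
    show IsSolution (linePotential 1 s ℓ (tortoiseRadius one_pos 0)) _
    rw [hV]
    exact UnitMass.isSolution_scale hψ M
  have hpar' : ∀ t y, ψ (M * -t) (M * y) = σ * ψ (M * t) (M * y) := fun t y => by
    rw [mul_neg]
    exact hpar (M * t) (M * y)
  have hE' : totalEnergy (linePotential 1 s ℓ (tortoiseRadius one_pos 0))
      (fun t y => ψ (M * t) (M * y)) 0 ≠ ⊤ := by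
    rw [hV, UnitMass.totalEnergy_scale hM, mul_zero]
    exact ENNReal.mul_ne_top ENNReal.ofReal_ne_top hE
  have K := H' s ℓ hs hsℓ (fun t y => ψ (M * t) (M * y)) hsol hpar'
    (UnitMass.supported_scale hM hsupp) hE'
  have ha : M * (ρ / M - h₁) = ρ - M * h₁ := by
    rw [mul_sub, mul_div_cancel₀ ρ hM.ne']
  rw [hV, UnitMass.totalEnergy_scale hM, mul_zero, UnitMass.channelEnergy_scale hM, ha,
    mul_left_comm] at K
  exact (ENNReal.mul_le_mul_iff_right (ENNReal.ofReal_pos.2 hM).ne' ENNReal.ofReal_ne_top).1 K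

end Summit.FinalStateConjecture.FinalStateConjecture.Theorems.WindowedShellChannelsStubs

end
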